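import Literature.MathematicalPhysics.QuantumFieldTheory.Balaban1983to89.Beta.FluctuationProjection
import HarnessLib

/-!
# NE7StraightSliceB5GreenSplit — row NE7 (node U5), the (A)-bill's XL(c) docking, file D5 (vi′) of `t4/b2b-balaban-t4-ne7-p2/g84/XLC-DOCKING-MEMO.md` §8–§9:
# THE XL(c) LETTER SPLIT INTO BAŁABAN's THREE PRINTED SUP BOUNDS — with the β sub-cell's `H_k = GQ*(QGQ*)⁻¹` ((1.103), `Beta.FluctuationProjection.Hk`) the
# constrained Green operator is `C = G − H_k·Q·G`, so `|∂_n(CJ)|_∞ ≤ (C₁ + C_H·C₀)·|J|_∞` follows from `|∂_n GJ| ≤ C₁|J|`, `|GJ| ≤ C₀|J|` ((1.115)) and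
# `|∂_n H_kB| ≤ C_H|B|` (the gradient bound for `H_k`), because `Q_k` does not increase sup norms

Lineage `b2b-balaban-t4-ne7-p2` (CRUX PROVER NE7 #2, co-owner of row NE7), generation 84.  ENTIRELY IN lit-balaban's SYMBOLS over `Beta.FluctuationProjection` (β sub-cell:
`Hk`, `QvOp_mul_Hk : Q·H_k = 1`, `DeltaA_mul_Hk : Δ_a·H_k = Q*(QGQ*)⁻¹`; `calG = Δ_a⁻¹` (1.71) with `DeltaA_mul_calG`), `B5Block118` (`QvOp_mulVec`, `lineSum`), `B5Action121`
(`CurlOp`, `star_mulVec_dotProduct`), `B5DeltaA169` (`QvAdj`).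
WHAT ([folklore] bookkeeping; [cite: Balaban1984PropagatorsI, (1.18) p.20, (1.71) p.30, (1.103) p.34, (1.115) p.36]).  §1 **`norm_QvOp_mulVec_le`**: `|Q_kA|_∞ ≤ |A|_∞` ((1.18) is an
average of `n^{d+1}` values).  §2 the operator `C′ := G − H_k·Q·G` (no new definition; `G = calG`): **`QvOp_mul_cSplit`** (`Q·C′ = 0`), **`DeltaA_mul_cSplit`** (`Δ_a·C′ = I − Q*(QGQ*)⁻¹QG`),
**`form_DeltaA_cSplit`** (`⟨β, Δ_a(C′J)⟩ = ⟨β, J⟩` for `β ∈ ker Q_k`) — so `C′` is a constrained solution operator in the sense of (147) `rankOneSourceSolver_of_solutionOperator`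
(and equals (148)'s `cGreen` once `calG = (Δ_a)⁻¹` is rewritten).  §3 **`curl_cSplit_bound`** — THE SPLIT: from the three DISPLAYED sup bounds `hG1 : |∂_c(GJ)| ≤ C₁·|J|_∞`,
`hG0 : |GJ| ≤ C₀·|J|_∞`, `hH1 : |∂_c(H_kB)| ≤ C_H·|B|_∞` (any lattice factor `c`), `|∂_c(C′J)| ≤ (C₁ + C_H·C₀)·|J|_∞` pointwise.  So the (A)-bill's XL(c) (memo §8: the ONE
hypothesis `hGb` of (147) §5) is Bałaban's (1.115) for `G` (entries `|GJ|`, `|∇GJ|`; lit-balaban `B5Prop12GHolds.global115_117_famG_printed`, PROVED there on the torus family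
of record) plus the gradient sup bound for `H_k` («This representation allows us to reduce a proof of properties of H_k to the corresponding properties of G», p. 34) —
each to be read off lit-balaban's `Setting` dictionary for the concrete `Tor (fine L^(k+1) (N,…,N))` (the OWNER's).
HONEST FRAMING (page 1): [folklore] bookkeeping on the β sub-cell's typed operators; NO estimate (the three bounds are DISPLAYED hypotheses); nothing of Bałaban's asserted;
NOT (APE), NOT ONE-STEP, NOT NE7; spine 0∕9; finite T⁴ rung (B)+1 — NOT infinite volume, NOT mass gap, NOT Clay.  Continuum YM on T⁴ ⇐ BetaPertH ∧ nine spine estimates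
(0/9 proved); BetaPertH ⇐ (D1) ∧ (D4) ∧ CAP+tail; G-an2-4 gates asym, D1 and NE2/3/4.
-/

set_option autoImplicit false

open scoped BigOperators Matrix ComplexConjugate ComplexOrder
open Finset

namespace Summit.QuantumFields.BalabanUV.T4Continuum.NE7StraightSliceB5GreenSplit

open Literature.MathematicalPhysics.QuantumFieldTheory.Balaban1983to89
open B5Prop11Plancherel (Tor fine calG)
open B5Action121 (CurlOp star_mulVec_dotProduct)
open B5Block118 (QvOp QvOp_mulVec lineSum bpt)
open B5DeltaA169 (DeltaA QvAdj DeltaA_mul_calG)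

open Beta.FluctuationProjection (Hk QGQ QvOp_mul_Hk DeltaA_mul_Hk)

noncomputable section

variable {d : ℕ} (n : ℕ) [NeZero n] (hn : 1 ≤ n) (M : Fin d → ℕ) [hM : ∀ μ, NeZero (M μ)] (a : ℝ) (ha : 0 < a)

/-! ## §1 `Q_k` does not increase sup norms -/

omit [NeZero n] hM in
/-- one block line of (1.18) is bounded by `n·|A|_∞`. [cite: Balaban1984PropagatorsI, (1.18) p.20] -/
theorem norm_lineSum_le {A : Tor (fine n M) × Fin d → ℂ} {g : ℝ} (hA : ∀ p, ‖A p‖ ≤ g) (x : Tor (fine n M)) (μ : Fin d) :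
    ‖lineSum n M A x μ‖ ≤ n * g := by
  unfold B5Block118.lineSum
  calc ‖∑ t : Fin n, A (x + B5Block118.tstep (fine n M) μ t, μ)‖ ≤ ∑ t : Fin n, ‖A (x + B5Block118.tstep (fine n M) μ t, μ)‖ := norm_sum_le _ _
    _ ≤ ∑ _t : Fin n, g := Finset.sum_le_sum fun t _ => hA _
    _ = n * g := by rw [Finset.sum_const, Finset.card_univ, Fintype.card_fin, nsmul_eq_mul]

/-- **`|Q_kA|_∞ ≤ |A|_∞`**: (1.18) is the average of `n^{d+1}` bond values. [cite: Balaban1984PropagatorsI, (1.18) p.20] -/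
theorem norm_QvOp_mulVec_le {A : Tor (fine n M) × Fin d → ℂ} {g : ℝ} (hA : ∀ p, ‖A p‖ ≤ g) (q : Tor M × Fin d) : ‖(QvOp n M *ᵥ A) q‖ ≤ g := by
  obtain ⟨y, μ⟩ := q
  have hn0 : (0 : ℝ) < n := by exact_mod_cast Nat.pos_of_ne_zero (NeZero.ne n)
  have hg : 0 ≤ g := (norm_nonneg _).trans (hA (0, μ))
  rw [QvOp_mulVec, norm_mul, norm_div, norm_one, norm_pow, Complex.norm_natCast]
  calc 1 / (n : ℝ) ^ (d + 1) * ‖∑ j : Fin d → Fin n, lineSum n M A (bpt n M y j) μ‖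
      ≤ 1 / (n : ℝ) ^ (d + 1) * ∑ j : Fin d → Fin n, ‖lineSum n M A (bpt n M y j) μ‖ :=
        mul_le_mul_of_nonneg_left (norm_sum_le _ _) (by positivity)
    _ ≤ 1 / (n : ℝ) ^ (d + 1) * ∑ _j : Fin d → Fin n, (n : ℝ) * g :=
        mul_le_mul_of_nonneg_left (Finset.sum_le_sum fun j _ => norm_lineSum_le n M hA _ _) (by positivity)
    _ = g := by
        rw [Finset.sum_const, Finset.card_univ, Fintype.card_fun, Fintype.card_fin, Fintype.card_fin, nsmul_eq_mul]
        push_cast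
        field_simp
        ring

/-! ## §2 `C′ = G − H_k·Q·G` is a constrained solution operator of `Δ_a` on `ker Q_k` -/

/-- **`Q·(G − H_kQG) = 0`** (`Q·H_k = 1`). [cite: Balaban1984PropagatorsI, (1.103) p.34] -/
theorem QvOp_mul_cSplit : QvOp n M * (calG n hn M a ha - Hk n hn M a ha * QvOp n M * calG n hn M a ha) = 0 := by
  rw [Matrix.mul_sub, ← Matrix.mul_assoc, ← Matrix.mul_assoc, QvOp_mul_Hk, Matrix.one_mul, sub_self]

/-- **`Δ_a·(G − H_kQG) = I − Q*(QGQ*)⁻¹QG`** (`Δ_aG = I`, `Δ_aH_k = Q*(QGQ*)⁻¹`). [cite: Balaban1984PropagatorsI, (1.71) p.30, (1.98)∕(1.102) p.34] -/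
theorem DeltaA_mul_cSplit :
    DeltaA n M a * (calG n hn M a ha - Hk n hn M a ha * QvOp n M * calG n hn M a ha)
      = 1 - QvAdj n M * (QGQ n hn M a ha)⁻¹ * QvOp n M * calG n hn M a ha := by
  rw [Matrix.mul_sub, DeltaA_mul_calG, ← Matrix.mul_assoc, ← Matrix.mul_assoc, DeltaA_mul_Hk]

/-- **`⟨β, Δ_a((G − H_kQG)J)⟩ = ⟨β, J⟩` for `β ∈ ker Q_k`**: `C′ = G − H_kQG` solves `Δ_a`'s constrained weak equation. [cite: Balaban1984PropagatorsI, (1.102)–(1.103) p.34] -/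
theorem form_DeltaA_cSplit (J : Tor (fine n M) × Fin d → ℂ) {β : Tor (fine n M) × Fin d → ℂ} (hβ : QvOp n M *ᵥ β = 0) :
    star β ⬝ᵥ (DeltaA n M a *ᵥ ((calG n hn M a ha - Hk n hn M a ha * QvOp n M * calG n hn M a ha) *ᵥ J)) = star β ⬝ᵥ J := by
  rw [Matrix.mulVec_mulVec, DeltaA_mul_cSplit, Matrix.sub_mulVec, Matrix.one_mulVec, dotProduct_sub]
  simp only [Matrix.mul_assoc, ← Matrix.mulVec_mulVec]
  -- `range Q*` pairs to zero against `ker Q`: `⟨β, Q*w⟩ = n^d·⟨Qβ, w⟩ = 0` ((148) `NE7StraightSliceB5Green.dotProduct_QvAdj_mulVec_of_ker`, inlined)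
  rw [QvAdj, Matrix.smul_mulVec, dotProduct_smul, ← star_mulVec_dotProduct, hβ, star_zero, zero_dotProduct, smul_zero, sub_zero]

/-- the two solution-operator clauses of (147) `rankOneSourceSolver_of_solutionOperator` for `C′ = G − H_kQG`. [folklore] -/
theorem cSplit_solutionOperator :
    (∀ J : Tor (fine n M) × Fin d → ℂ, QvOp n M *ᵥ ((calG n hn M a ha - Hk n hn M a ha * QvOp n M * calG n hn M a ha) *ᵥ J) = 0)
      ∧ ∀ (J β : Tor (fine n M) × Fin d → ℂ), QvOp n M *ᵥ β = 0 →
        star β ⬝ᵥ (DeltaA n M a *ᵥ ((calG n hn M a ha - Hk n hn M a ha * QvOp n M * calG n hn M a ha) *ᵥ J)) = star β ⬝ᵥ J :=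
  ⟨fun J => by rw [Matrix.mulVec_mulVec, QvOp_mul_cSplit, Matrix.zero_mulVec], fun J _ hβ => form_DeltaA_cSplit n hn M a ha J hβ⟩

/-! ## §3 The split of the XL(c) letter into three sup bounds -/

/-- `∂(C′J) = ∂(GJ) − ∂(H_k(Q(GJ)))`. [folklore] -/
theorem CurlOp_mulVec_cSplit (c : ℂ) (J : Tor (fine n M) × Fin d → ℂ) :
    CurlOp (fine n M) c *ᵥ ((calG n hn M a ha - Hk n hn M a ha * QvOp n M * calG n hn M a ha) *ᵥ J)
      = CurlOp (fine n M) c *ᵥ (calG n hn M a ha *ᵥ J) - CurlOp (fine n M) c *ᵥ (Hk n hn M a ha *ᵥ (QvOp n M *ᵥ (calG n hn M a ha *ᵥ J))) := by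
  rw [Matrix.sub_mulVec, Matrix.mulVec_sub, ← Matrix.mulVec_mulVec, ← Matrix.mulVec_mulVec]

/-- **THE XL(c) LETTER SPLIT INTO BAŁABAN's THREE SUP BOUNDS**: if `|∂_c(GJ)| ≤ C₁·g`, `|GJ| ≤ C₀·g` whenever `|J| ≤ g` ((1.115) for `G`), and `|∂_c(H_kB)| ≤ C_H·g′`
whenever `|B| ≤ g′` (the gradient bound for `H_k = GQ*(QGQ*)⁻¹`), then `|∂_c((G − H_kQG)J)| ≤ (C₁ + C_H·C₀)·g` whenever `|J| ≤ g`.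
[cite: Balaban1984PropagatorsI, (1.103) p.34, (1.115) p.36] -/
theorem curl_cSplit_bound (c : ℂ) {C₁ C₀ CH : ℝ}
    (hG1 : ∀ (J : Tor (fine n M) × Fin d → ℂ) (g : ℝ), (∀ p, ‖J p‖ ≤ g) → ∀ q, ‖(CurlOp (fine n M) c *ᵥ (calG n hn M a ha *ᵥ J)) q‖ ≤ C₁ * g)
    (hG0 : ∀ (J : Tor (fine n M) × Fin d → ℂ) (g : ℝ), (∀ p, ‖J p‖ ≤ g) → ∀ p, ‖(calG n hn M a ha *ᵥ J) p‖ ≤ C₀ * g)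
    (hH1 : ∀ (B : Tor M × Fin d → ℂ) (g : ℝ), (∀ p, ‖B p‖ ≤ g) → ∀ q, ‖(CurlOp (fine n M) c *ᵥ (Hk n hn M a ha *ᵥ B)) q‖ ≤ CH * g)
    (J : Tor (fine n M) × Fin d → ℂ) (g : ℝ) (hJ : ∀ p, ‖J p‖ ≤ g) (q : Tor (fine n M) × (Fin d × Fin d)) :
    ‖(CurlOp (fine n M) c *ᵥ ((calG n hn M a ha - Hk n hn M a ha * QvOp n M * calG n hn M a ha) *ᵥ J)) q‖ ≤ (C₁ + CH * C₀) * g := by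
  rw [CurlOp_mulVec_cSplit, Pi.sub_apply]
  have h1 := hG1 J g hJ q
  have hQ : ∀ p, ‖(QvOp n M *ᵥ (calG n hn M a ha *ᵥ J)) p‖ ≤ C₀ * g := fun p => norm_QvOp_mulVec_le n M (hG0 J g hJ) p
  have h2 := hH1 _ (C₀ * g) hQ q
  calc _ ≤ ‖(CurlOp (fine n M) c *ᵥ (calG n hn M a ha *ᵥ J)) q‖ + ‖(CurlOp (fine n M) c *ᵥ (Hk n hn M a ha *ᵥ (QvOp n M *ᵥ (calG n hn M a ha *ᵥ J)))) q‖ :=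
        norm_sub_le _ _
    _ ≤ C₁ * g + CH * (C₀ * g) := add_le_add h1 h2
    _ = (C₁ + CH * C₀) * g := by ring

end

end Summit.QuantumFields.BalabanUV.T4Continuum.NE7StraightSliceB5GreenSplit
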